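import Mathlib.Data.Nat.Log
import Literature.Barriers.PneNP.AlgebrizationForcing
import Literature.Computability.Complexity.CircuitComposition
import Literature.Computability.Complexity.AlgebrizationCollapse
import Literature.Computability.Complexity.AlgebrizationSeparation
import HarnessLib

/-!
# Aaronson–Wigderson Thm. 5.6: the limit construction and the linear-size oracle circuits

Discharge (D-0014) of the named fact `Literature.Barriers.PneNP.Algebrization_npLinearSize`
(`Literature/Barriers/PneNP/Algebrization.lean`): there are an oracle language `A` and a
multiquadratic extension `Ã` of `A` over every prime field with
`NP^Ã ⊆ ⋃ c, SIZE^A(c·n + c)` — the `NP` corollary of S. Aaronson, A. Wigderson, *Algebrization: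
a new barrier in complexity theory* (STOC 2008; full version, 50 pp.), Thm. 5.6 (pp. 26–27):
"There exist `A, Ã` such that `NTIME^Ã(2ⁿ) ⊂ SIZE^A(n)`", in the tree's transcript model of
oracle computation (`OracleAlg`, `PRel`, `NPRel`, `ExtensionOracle.toOracle`) and over the tree's
oracle circuits `SIZERel` (circuits over `B₂ ∪ oracleGates A`, an `A_m`-gate charged its fan-in).

One stage of AW's iterative forcing process (including Lemma 4.5 and the union bound) is the
theorem `AW56.exists_stage` of `Literature/Barriers/PneNP/AlgebrizationForcing.lean`. This file
supplies the rest of the printed proof, entirely proved: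

* `AW56.exists_budget_le`: the query budget `q(2n + 2 + p(n))` of a fixed nondeterministic
  polynomial-time machine is `≤ 2ⁿ` for all large `n` (elementary: `n^d ≤ 2ⁿ` once `4^d ≤ n`),
  so every machine is eventually among the pairs handled by the stages (AW clock the machines at
  `2ⁿ` outright, p. 26).
* `AW56.seq`, `AW56.stage`: the stages run over all arities `ℓ = 0, 1, 2, …` ("We construct `Ã`
  in stages", p. 27), each from the points fixed so far (at most `ybound ℓ ≤ 16^{ℓ/8}` of them at
  a coding arity, `AW56.ybound_le`) and the current world; `AW56.Efin`/`AW56.Afin`: the limit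
  extension oracle and language (arity `m` is frozen after stage `m`), `AW56.isExtensionOf_Afin`.
* `AW56.agrees_seq`, `AW56.agrees_stage_Efin`: later stages never change frozen polynomials or
  fixed values ("Once `y` is inactive, it never again becomes active, and `p(y)` never again
  changes", p. 26); hence forced pairs accept relative to the limit (`AW56.acc_of_mem_Sat`) and,
  by the halting condition of the process and locality of acceptance, no other handled pair
  accepts (`AW56.mem_Sat_of_acc`: "doing so cannot cause any additional `⟨i, x⟩` pairs to accept,
  for if it could, then we would have already forced those pairs to accept during the iterative
  process", p. 26).
* `AW56.exists_lookup_circuit`, `AW56.cktSize_lits`: the circuit "will now just hardwire the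
  string `z'`" (p. 26): `8n` unary/constant `B₂`-gates computing `z ⊕ w_{k,x}` and one
  `A_{8n}`-gate, fan-in-charged size `≤ 16n + 1`; small lengths use the Shannon-expansion circuit
  of the slice (`cktSize_univ`), absorbed in the constant.
* `AW56.npRel_subset` and the discharge `Algebrization_npLinearSize_holds`.

## Also here: discharge of the barrier fact `Algebrization` (AW Thm. 5.1 and Thm. 5.3)

The barrier fact `Literature.Barriers.PneNP.Algebrization` of `Algebrization.lean` is, by
definition, the conjunction of the tree facts `aaronson_wigderson_collapse` (AW Thm. 5.1, p. 23:
"There exist `A, Ã` such that `NP^Ã ⊆ P^A`") and `aaronson_wigderson_separation` (AW Thm. 5.3,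
pp. 23–24: "There exist `A, Ã` such that `NP^A ⊄ P^Ã`") of `StructuralPH.lean`, both PROVED with
no hypothesis in `Literature/Computability/Complexity/AlgebrizationCollapse.lean`
(`aaronson_wigderson_collapse_holds`: `Ã` the multilinear extension of the encoding-technique
oracle `A = K(Ã)`, Ko 1989 §5 — the tree has no relativised `PSPACE`, so AW's own witness, a
`PSPACE`-complete `A`, is replaced, the statement being theirs verbatim) and
`Literature/Computability/Complexity/AlgebrizationSeparation.lean`
(`aaronson_wigderson_separation_holds`: AW's proof verbatim — the Baker–Gill–Solovay
diagonalization armed with the algebraic query Lemma 4.5 over all prime fields, `Ã`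
multiquadratic). The discharge `Algebrization_holds` (last section) is `Algebrization.of_aw` fed
with these two theorems; the no-go theorems of `Algebrization.lean`, stated there under
`(h : Algebrization)`, are then recorded hypothesis-free (`not_isAlgebrizingSeparation_NP_P`,
`not_isAlgebrizingInclusion_NP_P`, `algebrization_summary`, `algebrization_oracles`).

## References

* S. Aaronson, A. Wigderson, *Algebrization: a new barrier in complexity theory*, STOC 2008 (full
  version), Thm. 5.6 (pp. 26–27), Lemma 4.5 (pp. 19–20), §1.2 p. 3; Def. 2.3 (p. 9), Thm. 5.1,
  Thm. 5.3 (pp. 23–24) [AaronsonWigderson2008].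
* K.-I Ko, *Constructing oracles by lower bound techniques for circuits*, in: Combinatorics,
  Computing and Complexity (Kluwer, 1989) 30–76, §5 [Ko1989].
* S. Arora, B. Barak, *Computational Complexity: A Modern Approach*, CUP 2009, §3.4 (oracle
  machines), Claim 2.13 and Def. 6.1–6.2 (circuits) [AroraBarak2009].
-/

namespace Literature.Barriers.PneNP

namespace AW56

open _root_.Computability Literature.Computability.Complexity
  Literature.Computability.Complexity.Multiquadratic MvPolynomial Finset

/-! ### Growth: a fixed machine's query budget is eventually below `2ⁿ` -/

/-- A polynomial over `ℕ` is bounded by `p(1) · (n + 1)^{deg p}`. [folklore] -/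
theorem natPoly_eval_le (p : Polynomial ℕ) (n : ℕ) :
    p.eval n ≤ p.eval 1 * (n + 1) ^ p.natDegree := by
  rw [Polynomial.eval_eq_sum_range, Polynomial.eval_eq_sum_range, Finset.sum_mul]
  refine Finset.sum_le_sum fun i hi => ?_
  rw [one_pow, mul_one]
  refine Nat.mul_le_mul_left _ ?_
  calc n ^ i ≤ (n + 1) ^ i := Nat.pow_le_pow_left (Nat.le_succ n) i
    _ ≤ (n + 1) ^ p.natDegree :=
      Nat.pow_le_pow_right (Nat.succ_pos n) (Nat.lt_succ_iff.1 (Finset.mem_range.1 hi))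

/-- `m (m + 1) ≤ 2^{m+1}`. [folklore] -/
theorem mul_succ_le_two_pow (m : ℕ) : m * (m + 1) ≤ 2 ^ (m + 1) := by
  induction m with
  | zero => simp
  | succ m ih =>
    have h : m < 2 ^ m := Nat.lt_two_pow_self
    calc (m + 1) * (m + 1 + 1) = m * (m + 1) + 2 * (m + 1) := by ring
      _ ≤ 2 ^ (m + 1) + 2 * 2 ^ m := Nat.add_le_add ih (Nat.mul_le_mul_left 2 h)
      _ = 2 ^ (m + 1 + 1) := by rw [pow_succ, pow_succ]; omega

/-- Polynomial versus exponential growth, elementary form: `n^d ≤ 2ⁿ` as soon as `4^d ≤ n`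
(with `m = ⌊log₂ n⌋ ≥ 2d`: `n^d < 2^{(m+1)d} ≤ 2^{2^m} ≤ 2ⁿ`). [folklore] -/
theorem pow_le_two_pow {d n : ℕ} (h : 4 ^ d ≤ n) : n ^ d ≤ 2 ^ n := by
  have hn : n ≠ 0 := by
    have := Nat.one_le_pow d 4 (by norm_num)
    omega
  set m := Nat.log 2 n with hm
  have h1 : 2 ^ m ≤ n := Nat.pow_log_le_self 2 hn
  have h2 : n < 2 ^ (m + 1) := Nat.lt_pow_succ_log_self (by norm_num) n
  have h3 : 2 * d ≤ m := by
    refine Nat.le_log_of_pow_le (by norm_num) ?_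
    have : (2 : ℕ) ^ (2 * d) = 4 ^ d := by rw [pow_mul]; norm_num
    rw [this]
    exact h
  have h4 : (m + 1) * d ≤ 2 ^ m := by
    have h5 := mul_succ_le_two_pow m
    have h6 : (m + 1) * (2 * d) ≤ (m + 1) * m := Nat.mul_le_mul_left _ h3
    have h7 : (m + 1) * (2 * d) = 2 * ((m + 1) * d) := by ring
    have h8 : (m + 1) * m = m * (m + 1) := by ring
    rw [pow_succ] at h5
    omega
  calc n ^ d ≤ (2 ^ (m + 1)) ^ d := Nat.pow_le_pow_left h2.le d
    _ = 2 ^ ((m + 1) * d) := by rw [← pow_mul]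
    _ ≤ 2 ^ (2 ^ m) := Nat.pow_le_pow_right (by norm_num) h4
    _ ≤ 2 ^ n := Nat.pow_le_pow_right (by norm_num) h1

/-- `C · (n + 1)^D ≤ 2ⁿ` for all `n ≥ max C 4^{D+2}`. [folklore] -/
theorem exists_mul_pow_le_two_pow (C D : ℕ) : ∃ N, ∀ n, N ≤ n → C * (n + 1) ^ D ≤ 2 ^ n := by
  refine ⟨max C (4 ^ (D + 2)), fun n hn => ?_⟩
  have hC : C ≤ n := (le_max_left _ _).trans hn
  have h4 : 4 ^ (D + 2) ≤ n + 1 := ((le_max_right _ _).trans hn).trans (Nat.le_succ n)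
  have h1 : C * (n + 1) ^ D ≤ (n + 1) ^ (D + 1) := by
    rw [pow_succ']
    exact Nat.mul_le_mul_right _ (by omega)
  have h2 : 2 * (n + 1) ^ (D + 1) ≤ (n + 1) ^ (D + 2) := by
    rw [pow_succ' _ (D + 1)]
    refine Nat.mul_le_mul_right _ ?_
    have : 1 ≤ n := by
      have := Nat.one_le_pow (D + 2) 4 (by norm_num)
      omega
    omega
  have h3 : (n + 1) ^ (D + 2) ≤ 2 ^ (n + 1) := pow_le_two_pow h4
  rw [pow_succ 2 n] at h3
  omega

/-- The query budget `q(2n + 2 + p(n))` of a fixed nondeterministic machine `(M, p, q)` is at most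
`2ⁿ` for all large `n` — so the machine is eventually among those simulated by the stages (AW
enumerate clocked `NTIME(2ⁿ)` machines and simulate `M₁, …, Mₙ` at length `n`).
[cite: AaronsonWigderson2008, Thm. 5.6 (proof, p. 26)] -/
theorem exists_budget_le (i : NPIdx) : ∃ N, ∀ n, N ≤ n → budget i n ≤ 2 ^ n := by
  set Ap := i.p.eval 1 with hAp
  set Dp := i.p.natDegree with hDp
  set Aq := i.q.eval 1 with hAq
  set Dq := i.q.natDegree with hDq
  obtain ⟨N, hN⟩ := exists_mul_pow_le_two_pow (Aq * (Ap + 3) ^ Dq) ((Dp + 1) * Dq)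
  refine ⟨N, fun n hn => le_trans ?_ (hN n hn)⟩
  have hp : i.p.eval n ≤ Ap * (n + 1) ^ Dp := natPoly_eval_le i.p n
  have harg : 2 * n + 2 + i.p.eval n + 1 ≤ (Ap + 3) * (n + 1) ^ (Dp + 1) := by
    have h1 : n + 1 ≤ (n + 1) ^ (Dp + 1) := by
      calc n + 1 = (n + 1) ^ 1 := (pow_one _).symm
        _ ≤ (n + 1) ^ (Dp + 1) := Nat.pow_le_pow_right (Nat.succ_pos n) (by omega)
    have h2 : (n + 1) ^ Dp ≤ (n + 1) ^ (Dp + 1) :=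
      Nat.pow_le_pow_right (Nat.succ_pos n) (by omega)
    have h3 : Ap * (n + 1) ^ Dp ≤ Ap * (n + 1) ^ (Dp + 1) := Nat.mul_le_mul_left _ h2
    calc 2 * n + 2 + i.p.eval n + 1 ≤ 3 * (n + 1) + Ap * (n + 1) ^ Dp := by omega
      _ ≤ 3 * (n + 1) ^ (Dp + 1) + Ap * (n + 1) ^ (Dp + 1) :=
        Nat.add_le_add (Nat.mul_le_mul_left 3 h1) h3
      _ = (Ap + 3) * (n + 1) ^ (Dp + 1) := by ring
  calc budget i n = i.q.eval (2 * n + 2 + i.p.eval n) := rfl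
    _ ≤ Aq * (2 * n + 2 + i.p.eval n + 1) ^ Dq := natPoly_eval_le i.q _
    _ ≤ Aq * ((Ap + 3) * (n + 1) ^ (Dp + 1)) ^ Dq :=
      Nat.mul_le_mul_left _ (Nat.pow_le_pow_left harg _)
    _ = Aq * (Ap + 3) ^ Dq * (n + 1) ^ ((Dp + 1) * Dq) := by rw [mul_pow, ← pow_mul, mul_assoc]

/-! ### One stage as data -/

/-- The outcome of one stage of the construction at arity `ℓ` (the data of `exists_stage`): the
halting configuration `c` of the forcing process, the hard-wired string `z`, and the new world `W`
whose slice at arity `ℓ` codes the satisfied pairs. [cite: AaronsonWigderson2008, Thm. 5.6 (proof, pp. 26–27)] -/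
structure StageOut (e : ℕ → NPIdx) (ℓ : ℕ) (Y₀ : Finset Point) (W₀ : World) where
  /-- the halting configuration of the iterative process -/
  c : Config
  /-- the hard-wired string `z'` -/
  z : Fin ℓ → Bool
  /-- the new world -/
  W : World
  /-- `c` is a valid configuration from `(Y₀, W₀)` -/
  valid : Valid e ℓ Y₀ W₀ c
  /-- `c` is halting -/
  terminal : Terminal e ℓ c
  /-- slices at other arities are those of `c.W` -/
  A_ne : ∀ m, m ≠ ℓ → W.A m = c.W.A m
  /-- polynomials at other arities are those of `c.W` -/
  poly_ne : ∀ (p : Nat.Primes) (m : ℕ), m ≠ ℓ → W.E.poly p m = c.W.E.poly p m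
  /-- the values at the fixed points are those of `c.W` -/
  val_eq : ∀ pt ∈ c.Y, val W.E pt = val c.W.E pt
  /-- the slice at arity `ℓ` codes the satisfied pairs -/
  code_spec : ∀ pr ∈ Pairs e ℓ, W.A ℓ (bxor z (code ℓ pr)) = decide (pr ∈ c.Sat)

/-- A stage exists (repackaging of `exists_stage`). [cite: AaronsonWigderson2008, Thm. 5.6 (proof, pp. 26–27)] -/
theorem nonempty_stageOut (e : ℕ → NPIdx) (ℓ : ℕ) (Y₀ : Finset Point) (W₀ : World)
    (h : 8 ∣ ℓ → Y₀.card ≤ 16 ^ (ℓ / 8)) : Nonempty (StageOut e ℓ Y₀ W₀) := by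
  obtain ⟨c, z, W, h1, h2, h3, h4, h5, h6⟩ := exists_stage e ℓ Y₀ W₀ h
  exact ⟨⟨c, z, W, h1, h2, h3, h4, h5, h6⟩⟩

/-- A chosen stage. [cite: AaronsonWigderson2008, Thm. 5.6 (proof, pp. 26–27)] -/
noncomputable def stageOut (e : ℕ → NPIdx) (ℓ : ℕ) (Y₀ : Finset Point) (W₀ : World)
    (h : 8 ∣ ℓ → Y₀.card ≤ 16 ^ (ℓ / 8)) : StageOut e ℓ Y₀ W₀ :=
  Classical.choice (nonempty_stageOut e ℓ Y₀ W₀ h)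

/-! ### The number of points fixed before stage `ℓ` -/

/-- A bound on the number of points fixed before stage `ℓ`: each coding arity `8s` adds at most
`|Pairs| · 2ˢ ≤ s · 4ˢ` points (AW: "`|D| ≤ n 2^{2n}`"). [cite: AaronsonWigderson2008, Thm. 5.6 (proof, pp. 26–27)] -/
def ybound : ℕ → ℕ
  | 0 => 0
  | ℓ + 1 => ybound ℓ + if 8 ∣ ℓ then ℓ / 8 * 4 ^ (ℓ / 8) else 0

/-- Between two coding arities only the coding arity contributes. [folklore] -/
theorem ybound_mul_add (s : ℕ) : ∀ j, j ≤ 7 → ybound (8 * s + j + 1) = ybound (8 * s) + s * 4 ^ s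
  | 0, _ => by
    show ybound (8 * s + 0) + _ = _
    rw [Nat.add_zero, if_pos (dvd_mul_right 8 s), Nat.mul_div_cancel_left s (by norm_num)]
  | j + 1, hj => by
    rw [show 8 * s + (j + 1) + 1 = (8 * s + j + 1) + 1 from by ring]
    show ybound (8 * s + j + 1) + _ = _
    rw [ybound_mul_add s j (by omega), if_neg (by omega), Nat.add_zero]

/-- At the coding arity `8s` at most `16ˢ` points have been fixed (AW p. 27:
`Σ_{m<n} m 2^{2m} ≤ n 2^{2n}`). [cite: AaronsonWigderson2008, Thm. 5.6 (proof, p. 27)] -/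
theorem ybound_mul_le (s : ℕ) : ybound (8 * s) ≤ 16 ^ s := by
  induction s with
  | zero => simp [ybound]
  | succ s ih =>
    rw [show 8 * (s + 1) = 8 * s + 7 + 1 from by ring, ybound_mul_add s 7 le_rfl]
    have h1 : s ≤ 4 ^ s := (Nat.lt_two_pow_self).le.trans (Nat.pow_le_pow_left (by norm_num) s)
    calc ybound (8 * s) + s * 4 ^ s ≤ 16 ^ s + 4 ^ s * 4 ^ s :=
        Nat.add_le_add ih (Nat.mul_le_mul_right _ h1)
      _ = 16 ^ s + 16 ^ s := by rw [← mul_pow]; norm_num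
      _ ≤ 16 ^ (s + 1) := by rw [pow_succ]; omega

/-- The hypothesis of `exists_stage` at coding arities. [cite: AaronsonWigderson2008, Thm. 5.6 (proof, p. 27)] -/
theorem ybound_le {ℓ : ℕ} (h : 8 ∣ ℓ) : ybound ℓ ≤ 16 ^ (ℓ / 8) := by
  obtain ⟨s, rfl⟩ := h
  rw [Nat.mul_div_cancel_left s (by norm_num)]
  exact ybound_mul_le s

/-! ### The sequence of stages over all arities -/

/-- The input of stage `ℓ`: the points fixed so far and the current world, with the cardinality
invariant. [cite: AaronsonWigderson2008, Thm. 5.6 (proof, p. 27: "At stage n, assume …")] -/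
structure Pre (ℓ : ℕ) where
  /-- the points fixed before stage `ℓ` -/
  Y : Finset Point
  /-- the world before stage `ℓ` -/
  W : World
  /-- the cardinality invariant -/
  card_le : Y.card ≤ ybound ℓ

/-- The cardinality hypothesis of `exists_stage` holds for a stage input. [folklore] -/
theorem Pre.hyp {ℓ : ℕ} (P : Pre ℓ) : 8 ∣ ℓ → P.Y.card ≤ 16 ^ (ℓ / 8) :=
  fun h => P.card_le.trans (ybound_le h)

/-- The stage run on a stage input. [cite: AaronsonWigderson2008, Thm. 5.6 (proof, pp. 26–27)] -/
noncomputable def Pre.out (e : ℕ → NPIdx) {ℓ : ℕ} (P : Pre ℓ) : StageOut e ℓ P.Y P.W :=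
  stageOut e ℓ P.Y P.W P.hyp

/-- The cardinality invariant is preserved: `|c.Y| ≤ |Y₀| + |Sat| · 2ˢ ≤ ybound ℓ + s 4ˢ`.
[cite: AaronsonWigderson2008, Thm. 5.6 (proof: "`|D| ≤ n 2^{2n}`")] -/
theorem card_next_le (e : ℕ → NPIdx) {ℓ : ℕ} (P : Pre ℓ) : (P.out e).c.Y.card ≤ ybound (ℓ + 1) := by
  obtain ⟨-, -, hsat, hcard, -⟩ := (P.out e).valid
  refine hcard.trans ?_
  show _ ≤ ybound ℓ + _
  refine Nat.add_le_add P.card_le ?_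
  by_cases h8 : 8 ∣ ℓ
  · rw [if_pos h8]
    calc (P.out e).c.Sat.card * 2 ^ (ℓ / 8) ≤ (Pairs e ℓ).card * 2 ^ (ℓ / 8) :=
        Nat.mul_le_mul_right _ (card_le_card hsat)
      _ ≤ ℓ / 8 * 2 ^ (ℓ / 8) * 2 ^ (ℓ / 8) := Nat.mul_le_mul_right _ (card_Pairs_le e ℓ)
      _ = ℓ / 8 * 4 ^ (ℓ / 8) := by rw [mul_assoc, ← mul_pow]; norm_num
  · rw [if_neg h8]
    have : (P.out e).c.Sat = ∅ := subset_empty.1 (hsat.trans (by simp [Pairs, h8]))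
    simp [this]

/-- **The stages over all arities** `ℓ = 0, 1, 2, …`: stage `ℓ` starts from the points fixed and
the world produced by the stages `< ℓ` (arities not divisible by `8` carry no pairs; their stage
only freezes the polynomials). [cite: AaronsonWigderson2008, Thm. 5.6 (proof, p. 27: "We construct Ã in stages")] -/
noncomputable def seq (e : ℕ → NPIdx) : (ℓ : ℕ) → Pre ℓ
  | 0 => ⟨∅, World.empty, by simp [ybound]⟩
  | ℓ + 1 => ⟨((seq e ℓ).out e).c.Y, ((seq e ℓ).out e).W, card_next_le e (seq e ℓ)⟩

/-- Stage `ℓ` of the construction. [cite: AaronsonWigderson2008, Thm. 5.6 (proof, pp. 26–27)] -/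
noncomputable def stage (e : ℕ → NPIdx) (ℓ : ℕ) : StageOut e ℓ (seq e ℓ).Y (seq e ℓ).W :=
  (seq e ℓ).out e

/-- The points fixed before stage `ℓ + 1` are those of the halting configuration of stage `ℓ`.
[folklore] -/
theorem seq_succ_Y (e : ℕ → NPIdx) (ℓ : ℕ) : (seq e (ℓ + 1)).Y = (stage e ℓ).c.Y := rfl

/-- The world before stage `ℓ + 1` is the world produced by stage `ℓ`. [folklore] -/
theorem seq_succ_W (e : ℕ → NPIdx) (ℓ : ℕ) : (seq e (ℓ + 1)).W = (stage e ℓ).W := rfl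

/-- Stage `ℓ` does not change the polynomials at arities `< ℓ`.
[cite: AaronsonWigderson2008, Thm. 5.6 (proof, p. 27: "Ã_{1,F}, …, Ã_{n-1,F} have already been fixed")] -/
theorem poly_seq_succ (e : ℕ → NPIdx) (ℓ : ℕ) (p : Nat.Primes) {m : ℕ} (hm : m < ℓ) :
    (seq e (ℓ + 1)).W.E.poly p m = (seq e ℓ).W.E.poly p m := by
  rw [seq_succ_W, (stage e ℓ).poly_ne p m hm.ne]
  exact (stage e ℓ).valid.2.1.1 p m hm

/-- Stage `ℓ` does not change the values at the points fixed before it.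
[cite: AaronsonWigderson2008, Thm. 5.6 (proof, p. 26: "p(y) never again changes")] -/
theorem val_seq_succ (e : ℕ → NPIdx) (ℓ : ℕ) {pt : Point} (hpt : pt ∈ (seq e ℓ).Y) :
    val (seq e (ℓ + 1)).W.E pt = val (seq e ℓ).W.E pt := by
  rw [seq_succ_W, (stage e ℓ).val_eq pt ((stage e ℓ).valid.1 hpt)]
  exact (stage e ℓ).valid.2.1.2 pt hpt

/-- Fixed points stay fixed. [cite: AaronsonWigderson2008, Thm. 5.6 (proof, p. 26: "Once y is inactive, it never again becomes active")] -/
theorem Y_subset_succ (e : ℕ → NPIdx) (ℓ : ℕ) : (seq e ℓ).Y ⊆ (seq e (ℓ + 1)).Y :=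
  (stage e ℓ).valid.1

/-- Fixed points stay fixed (any number of stages). [cite: AaronsonWigderson2008, Thm. 5.6 (proof, p. 26)] -/
theorem Y_mono (e : ℕ → NPIdx) {ℓ ℓ' : ℕ} (h : ℓ ≤ ℓ') : (seq e ℓ).Y ⊆ (seq e ℓ').Y := by
  induction h with
  | refl => exact Subset.rfl
  | step _ ih => exact ih.trans (Y_subset_succ e _)

/-- **Later stages agree with earlier ones**: the world before stage `ℓ'` has the same
polynomials at arities `< ℓ` and the same values at the points fixed before stage `ℓ ≤ ℓ'`.
[cite: AaronsonWigderson2008, Thm. 5.6 (proof, pp. 26–27)] -/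
theorem agrees_seq (e : ℕ → NPIdx) {ℓ ℓ' : ℕ} (h : ℓ ≤ ℓ') :
    Agrees ℓ (seq e ℓ).Y (seq e ℓ).W.E (seq e ℓ').W.E := by
  induction h with
  | refl => exact Agrees.rfl
  | @step ℓ' hℓ ih =>
    exact ih.trans (Y' := (seq e ℓ).Y)
      ⟨fun p m hm => poly_seq_succ e ℓ' p (hm.trans_le hℓ),
        fun pt hpt => val_seq_succ e ℓ' (Y_mono e hℓ hpt)⟩ Subset.rfl

/-! ### The limit oracle -/

/-- **The extension oracle `Ã`**: the polynomial at arity `m` is the one in place after stage `m`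
(never changed afterwards, `Efin_poly`). [cite: AaronsonWigderson2008, Thm. 5.6 (proof, p. 27)] -/
noncomputable def Efin (e : ℕ → NPIdx) : ExtensionOracle :=
  ⟨fun p m => (seq e (m + 1)).W.E.poly p m⟩

/-- The limit world: the Boolean slices and polynomials in place after the stage of their arity.
[cite: AaronsonWigderson2008, Thm. 5.6 (proof, p. 27)] -/
noncomputable def Wfin (e : ℕ → NPIdx) : World :=
  ⟨fun m => (seq e (m + 1)).W.A m, Efin e, fun p m => (seq e (m + 1)).W.ok p m⟩

/-- **The oracle language `A`**: the language with the slices of the limit world.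
[cite: AaronsonWigderson2008, Thm. 5.6 (proof, pp. 26–27)] -/
noncomputable def Afin (e : ℕ → NPIdx) : Language Bool :=
  ({w : List Bool | (Wfin e).A w.length w.get = true} : Set (List Bool))

/-- Membership in `A` is given by the slices of the limit world. [folklore] -/
theorem boolIndicator_Afin (e : ℕ → NPIdx) (w : List Bool) :
    (Afin e).boolIndicator w = (Wfin e).A w.length w.get := by
  cases h : (Wfin e).A w.length w.get
  · exact (Set.notMem_iff_boolIndicator _ _).1 (show w ∉ {w : List Bool | _} by simp [h])
  · exact (Set.mem_iff_boolIndicator _ _).1 (show w ∈ {w : List Bool | _} by simpa using h)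

/-- The slices of `A` are the slices of the limit world. [folklore] -/
theorem sliceFn_Afin (e : ℕ → NPIdx) (m : ℕ) (v : Fin m → Bool) :
    (Afin e).sliceFn m v = (Wfin e).A m v := by
  have gen : ∀ (w : List Bool) (m : ℕ) (h : w.length = m),
      (Wfin e).A w.length w.get = (Wfin e).A m (fun i => w.get (i.cast h.symm)) := by
    rintro w _ rfl
    rfl
  rw [Language.sliceFn, boolIndicator_Afin, gen (List.ofFn v) m (List.length_ofFn ..)]
  congr 1
  funext i
  simp

/-- **`Ã` is a multiquadratic extension of `A`** (over every prime field).
[cite: AaronsonWigderson2008, Thm. 5.6 and Def. 2.2] -/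
theorem isExtensionOf_Afin (e : ℕ → NPIdx) : (Efin e).IsExtensionOf (Afin e) 2 := fun p m =>
  ⟨((seq e (m + 1)).W.ok p m).1, fun x => by
    rw [sliceFn_Afin]
    exact ((seq e (m + 1)).W.ok p m).2 x⟩

/-- The polynomial of `Ã` at arity `m` is the one of every stage input `ℓ > m`.
[cite: AaronsonWigderson2008, Thm. 5.6 (proof, p. 27)] -/
theorem Efin_poly (e : ℕ → NPIdx) (p : Nat.Primes) {m ℓ : ℕ} (hm : m < ℓ) :
    (Efin e).poly p m = (seq e ℓ).W.E.poly p m :=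
  ((agrees_seq e (Nat.succ_le_of_lt hm)).1 p m (Nat.lt_succ_self m)).symm

/-- `Ã` has the fixed values at the points fixed before any stage.
[cite: AaronsonWigderson2008, Thm. 5.6 (proof, p. 26: "p(y) never again changes")] -/
theorem val_Efin (e : ℕ → NPIdx) {ℓ : ℕ} {pt : Point} (hpt : pt ∈ (seq e ℓ).Y) :
    val (Efin e) pt = val (seq e ℓ).W.E pt := by
  obtain ⟨m, y⟩ := pt
  rcases lt_or_ge m ℓ with hm | hm
  · show eval y.2 ((Efin e).poly y.1 m) = eval y.2 ((seq e ℓ).W.E.poly y.1 m)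
    rw [Efin_poly e y.1 hm]
  · exact (agrees_seq e (Nat.le_succ_of_le hm)).2 _ hpt

/-- `Ã` agrees with the halting configuration of stage `ℓ` below arity `ℓ` and on its fixed
points. [cite: AaronsonWigderson2008, Thm. 5.6 (proof, pp. 26–27)] -/
theorem agrees_stage_Efin (e : ℕ → NPIdx) (ℓ : ℕ) :
    Agrees ℓ (stage e ℓ).c.Y (stage e ℓ).c.W.E (Efin e) := by
  refine ⟨fun p m hm => ?_, fun pt hpt => ?_⟩
  · rw [Efin_poly e p hm]
    exact ((stage e ℓ).valid.2.1.1 p m hm).symm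
  · rw [val_Efin e (ℓ := ℓ + 1) hpt]
    exact (stage e ℓ).val_eq pt hpt

/-! ### Which handled pairs accept relative to `Ã` -/

/-- Forced pairs accept relative to `Ã`. [cite: AaronsonWigderson2008, Thm. 5.6 (proof, p. 26)] -/
theorem acc_of_mem_Sat (e : ℕ → NPIdx) (ℓ : ℕ) {pr : ℕ × List Bool}
    (h : pr ∈ (stage e ℓ).c.Sat) : Acc (Efin e).toOracle (e pr.1) pr.2 :=
  (stage e ℓ).valid.2.2.2.2 pr h (Efin e) (agrees_stage_Efin e ℓ)

/-- **No other handled pair accepts relative to `Ã`**: an accepting computation is witnessed by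
`≤ 2ˢ` points of `Ã` (`Acc.local`), and fixing them (the limit world witnessing consistency) would
have been a further step of the halted forcing process ("doing so cannot cause any additional
`⟨i, x⟩` pairs to accept, for if it could, then we would have already forced those pairs to accept
during the iterative process"). [cite: AaronsonWigderson2008, Thm. 5.6 (proof, p. 26)] -/
theorem mem_Sat_of_acc (e : ℕ → NPIdx) (ℓ : ℕ) {pr : ℕ × List Bool} (hpr : pr ∈ Pairs e ℓ)
    (hacc : Acc (Efin e).toOracle (e pr.1) pr.2) : pr ∈ (stage e ℓ).c.Sat := by
  by_contra hnot
  obtain ⟨Y', hY'card, hY'⟩ := hacc.local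
  obtain ⟨-, -, hlen, hbud⟩ := (mem_Pairs_iff e ℓ pr).1 hpr
  have hcard : Y'.card ≤ 2 ^ (ℓ / 8) := hY'card.trans (by rw [hlen]; exact hbud)
  refine (stage e ℓ).terminal pr hpr hnot ((stage e ℓ).c.Y ∪ Y') (Wfin e) subset_union_left
    ((card_union_le _ _).trans (Nat.add_le_add_left hcard _)) (agrees_stage_Efin e ℓ) ?_
  intro E' hE'
  exact hY' E' fun pt hpt => hE'.2 pt (mem_union_right _ hpt)

/-! ### The oracle circuits -/

/-- The literal layer of the circuit at input length `n` for machine `k` and hard-wired string `z`: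
bit `j` of `z ⊕ w_{k,x}` is `z_j ⊕ x_j` (`j < n`), `¬ z_j` (`j = n + k`) or `z_j`.
[cite: AaronsonWigderson2008, Thm. 5.6 (proof, p. 26: "hardwire the string z'")] -/
def lits (n k : ℕ) {N : ℕ} (z : Fin N → Bool) (v : Fin n → Bool) : Fin N → Bool := fun j =>
  xor (z j) (if h : (j : ℕ) < n then v ⟨j, h⟩ else decide ((j : ℕ) = n + k))

/-- The literal layer computes `z ⊕ w_{k,x}`. [cite: AaronsonWigderson2008, Thm. 5.6 (proof, p. 26)] -/
theorem lits_eq_bxor_code (k : ℕ) (x : List Bool) {N : ℕ} (z : Fin N → Bool) :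
    lits x.length k z x.get = bxor z (code N (k, x)) := by
  funext j
  simp [lits, bxor, code]

/-- The literal layer costs `N` unary/constant `B₂`-gates. [cite: AaronsonWigderson2008, Thm. 5.6 (proof, p. 26)] -/
theorem cktSize_lits (n k : ℕ) {N : ℕ} (z : Fin N → Bool) : CktSize B2 (lits n k z) N := by
  have h : ∀ j : Fin N, CktSize B2 (fun (v : Fin n → Bool) (_ : Unit) => lits n k z v j) 1 := by
    intro j
    by_cases hj : (j : ℕ) < n
    · refine (CktSize.gate (B := B2) (ι := Fin n) ⟨1, fun w => xor (z j) (w 0)⟩ (by simp [B2])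
        fun _ => ⟨j, hj⟩).congr fun v _ => ?_
      simp [lits, hj]
    · refine (cktSize_const (Fin n) (xor (z j) (decide ((j : ℕ) = n + k)))).congr fun v _ => ?_
      simp [lits, hj]
  simpa using CktSize.pi_const h

/-- Over `B₂` the fan-in-charged cost of a gate list is its length. [folklore] -/
theorem sum_oracleGateCost_of_B2 {ι : Type*} :
    ∀ l : List (Gate ι), (∀ g ∈ l, g.fn ∈ B2) → (l.map fun g => oracleGateCost g.fn).sum = l.length
  | [], _ => rfl
  | g :: l, h => by
    simp only [List.map_cons, List.sum_cons, List.length_cons]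
    rw [sum_oracleGateCost_of_B2 l fun g' hg' => h g' (List.mem_cons_of_mem g hg'),
      oracleGateCost_of_le (h g List.mem_cons_self), Nat.add_comm]

/-- **The lookup circuit**: a `B₂`-program with `N` outputs `u` followed by one `A_N`-gate reading
them computes `x ↦ A_N(u(x))` at fan-in-charged cost `≤ s + N + 1` (AW's circuit: the hard-wired
`z' ⊕ w_{i,x}` fed into one oracle gate). [cite: AaronsonWigderson2008, Thm. 5.6 (proof, p. 26)] -/
theorem exists_lookup_circuit (A : Language Bool) {n N s : ℕ} {u : (Fin n → Bool) → Fin N → Bool}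
    (hu : CktSize B2 u s) :
    ∃ C : Circuit (Fin n), C.IsOver (B2 ∪ oracleGates A) ∧ oracleSize C ≤ s + N + 1 ∧
      ∀ v, C.eval v = A.sliceFn N (u v) := by
  obtain ⟨gs, out, hl, hR⟩ := hu
  let g : Gate (Fin n) := ⟨N, A.sliceFn N, fun a => out a⟩
  have hwf : GateList.WF (gs ++ [g]) := hR.wf.append_singleton fun a m ha => hR.outOK a m ha
  refine ⟨⟨gs ++ [g], .inr gs.length,
    fun j hj a m ha => hwf j _ (List.getElem?_eq_getElem hj) a m ha, ?_⟩, ?_, ?_, ?_⟩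
  · intro m hm
    simp only [Sum.inr.injEq] at hm
    subst hm
    simp
  · intro g' hg'
    rcases List.mem_append.1 hg' with h | h
    · exact Or.inl (hR.isOver g' h)
    · rw [List.mem_singleton] at h
      subst h
      exact Or.inr (sliceFn_mem_oracleGates A N)
  · show ((gs ++ [g]).map fun g => oracleGateCost g.fn).sum ≤ s + N + 1
    rw [List.map_append, List.sum_append, sum_oracleGateCost_of_B2 gs hR.isOver]
    have : oracleGateCost g.fn ≤ N + 1 := by
      show (if N ≤ 2 then 1 else N) ≤ N + 1
      split <;> omega
    simp only [List.map_cons, List.map_nil, List.sum_cons, List.sum_nil, Nat.add_zero]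
    omega
  · intro v
    show (GateList.vals (gs ++ [g]) v).getD gs.length false = A.sliceFn N (u v)
    rw [GateList.vals_append_singleton, List.getD_eq_getElem?_getD,
      List.getElem?_append_right (by simp), GateList.length_vals, Nat.sub_self]
    simp only [List.getElem?_cons_zero, Option.getD_some]
    show A.sliceFn N (fun a => GateList.wireOf v (GateList.vals gs v) (out a)) = A.sliceFn N (u v)
    congr 1
    funext a
    exact hR.eval v a

/-! ### `NP^Ã` has linear-size `A`-oracle circuits -/

/-- **`NP^Ã ⊆ ⋃ c, SIZE^A(c·n + c)`.** For `L ∈ NP^Ã` pick its machine `i = (M, p, q)` and an index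
`k` with `e k = i`; for the lengths `n > k` with `budget i n ≤ 2ⁿ` the pair `⟨k, x⟩` is handled at
arity `8n`, so `x ∈ L ⇔ Mₖ^Ã accepts x ⇔ ⟨k, x⟩ ∈ Sat ⇔ A_{8n}(z ⊕ w_{k,x}) = 1`, computed by the
lookup circuit of cost `≤ 16n + 1`; the finitely many other lengths use a circuit of the slice.
[cite: AaronsonWigderson2008, Thm. 5.6 (proof, pp. 26–27) and §1.2 p. 3] -/
theorem npRel_subset (e : ℕ → NPIdx)
    (he : ∀ i : NPIdx, i.M.IsPolyTime encodingBoolBool → ∃ k, e k = i) :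
    NPRel (Efin e).toOracle ⊆ ⋃ c : ℕ, SIZERel (Afin e) (fun n => c * n + c) := by
  classical
  intro L hL
  obtain ⟨i, hi, hLi⟩ := exists_idx_of_mem_NPRel hL
  obtain ⟨k, hk⟩ := he i hi
  obtain ⟨N₀, hN₀⟩ := exists_budget_le i
  -- semantics at the good lengths
  have hsem : ∀ x : List Bool, k < x.length → N₀ ≤ x.length →
      L.boolIndicator x =
        (Afin e).sliceFn (8 * x.length) (lits x.length k (stage e (8 * x.length)).z x.get) := by
    intro x hkx hNx
    have h8 : 8 * x.length / 8 = x.length := Nat.mul_div_cancel_left _ (by norm_num)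
    have hpr : (k, x) ∈ Pairs e (8 * x.length) := by
      refine (mem_Pairs_iff e _ _).2 ⟨dvd_mul_right 8 _, ?_, ?_, ?_⟩
      · show k < 8 * x.length / 8
        rw [h8]
        exact hkx
      · show x.length = 8 * x.length / 8
        rw [h8]
      · show budget (e k) (8 * x.length / 8) ≤ 2 ^ (8 * x.length / 8)
        rw [h8, hk]
        exact hN₀ _ hNx
    have hiff : x ∈ L ↔ (k, x) ∈ (stage e (8 * x.length)).c.Sat := by
      rw [hLi x, ← hk]
      exact ⟨mem_Sat_of_acc e _ hpr, acc_of_mem_Sat e _⟩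
    rw [lits_eq_bxor_code, sliceFn_Afin]
    show L.boolIndicator x = (stage e (8 * x.length)).W.A (8 * x.length)
      (bxor (stage e (8 * x.length)).z (code (8 * x.length) (k, x)))
    rw [(stage e (8 * x.length)).code_spec (k, x) hpr]
    by_cases hx : x ∈ L
    · rw [(Set.mem_iff_boolIndicator _ _).1 hx]
      exact (decide_eq_true (hiff.1 hx)).symm
    · rw [(Set.notMem_iff_boolIndicator _ _).1 hx]
      exact (decide_eq_false fun h => hx (hiff.2 h)).symm
  -- the circuits
  have hbig : ∀ n, ∃ C : Circuit (Fin n), C.IsOver (B2 ∪ oracleGates (Afin e)) ∧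
      oracleSize C ≤ 16 * n + 1 ∧
        ∀ v, C.eval v = (Afin e).sliceFn (8 * n) (lits n k (stage e (8 * n)).z v) := fun n => by
    obtain ⟨C, h1, h2, h3⟩ := exists_lookup_circuit (Afin e) (cktSize_lits n k (stage e (8 * n)).z)
    exact ⟨C, h1, by omega, h3⟩
  have hsmall : ∀ n, ∃ C : Circuit (Fin n), C.IsOver B2 ∧ ∀ v, C.eval v = L.sliceFn n v := fun n => by
    obtain ⟨C, hB, -, hC⟩ := (cktSize_univ fun (v : Fin n → Bool) (_ : Unit) => L.sliceFn n v).toCircuit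
    exact ⟨C, hB, hC⟩
  choose Cb hCb₁ hCb₂ hCb₃ using hbig
  choose Cs hCs₁ hCs₂ using hsmall
  set M := max (k + 1) N₀ with hM
  obtain ⟨c, hc17, hcS⟩ : ∃ c : ℕ, 17 ≤ c ∧ ∑ m ∈ range M, (Cs m).size ≤ c :=
    ⟨17 + ∑ m ∈ range M, (Cs m).size, by omega, by omega⟩
  refine Set.mem_iUnion.2 ⟨c, fun n => if k < n ∧ N₀ ≤ n then Cb n else Cs n, fun n => ?_, fun x => ?_⟩
  · dsimp only
    by_cases hn : k < n ∧ N₀ ≤ n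
    · rw [if_pos hn]
      have : 17 * n ≤ c * n := Nat.mul_le_mul_right n hc17
      exact ⟨hCb₁ n, (hCb₂ n).trans (by omega)⟩
    · rw [if_neg hn]
      refine ⟨(hCs₁ n).mono Set.subset_union_left, ?_⟩
      rw [sizeWith_oracleGateCost_of_isOver_B2 (hCs₁ n)]
      have hnM : n ∈ range M := by
        rw [mem_range, hM]
        omega
      have : (Cs n).size ≤ ∑ m ∈ range M, (Cs m).size :=
        single_le_sum (f := fun m => (Cs m).size) (fun m _ => Nat.zero_le _) hnM
      have : c ≤ c * n + c := Nat.le_add_left _ _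
      omega
  · show (if k < x.length ∧ N₀ ≤ x.length then Cb x.length else Cs x.length).eval x.get =
      L.boolIndicator x
    by_cases hn : k < x.length ∧ N₀ ≤ x.length
    · rw [if_pos hn, hCb₃, ← hsem x hn.1 hn.2]
    · rw [if_neg hn, hCs₂]
      simp [Language.sliceFn, List.ofFn_get]

end AW56

open AW56 in
/-- **Discharge of `Algebrization_npLinearSize`** (Aaronson–Wigderson Thm. 5.6, `NP` corollary:
"there exist `A, Ã` relative to which … `NP^Ã ⊂ SIZE^A(n)`", §1.2 p. 3): with `e` an enumeration
of the nondeterministic polynomial-time oracle machines (`exists_enum`), the limit language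
`A = Afin e` and extension oracle `Ã = Efin e` of the stage construction satisfy
`Ã.IsExtensionOf A 2` and `NP^Ã ⊆ ⋃ c, SIZE^A(c·n + c)`.
[cite: AaronsonWigderson2008, Thm. 5.6 (pp. 26–27) and §1.2 p. 3] -/
theorem Algebrization_npLinearSize_holds : Algebrization_npLinearSize := by
  obtain ⟨e, he⟩ := exists_enum
  exact ⟨Afin e, Efin e, isExtensionOf_Afin e, npRel_subset e he⟩

/-! ### Discharge of the barrier fact `Algebrization` (AW Thm. 5.1 and Thm. 5.3) -/

section AlgebrizationHolds

open Literature.Computability.Complexity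

/-- **Algebrization barrier for P versus NP, discharged** (Aaronson–Wigderson, Thm. 5.1: "There
exist `A, Ã` such that `NP^Ã ⊆ P^A`", and Thm. 5.3: "There exist `A, Ã` such that `NP^A ⊄ P^Ã`"):
the named fact `Algebrization` holds — it is the conjunction (`Algebrization.of_aw`) of the tree
theorems `aaronson_wigderson_collapse_holds` (`AlgebrizationCollapse.lean`) and
`aaronson_wigderson_separation_holds` (`AlgebrizationSeparation.lean`). Axioms: `propext`,
`Classical.choice`, `Quot.sound`. [cite: AaronsonWigderson2008, Thm. 5.1 and Thm. 5.3 (full version pp. 23–24)] -/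
theorem Algebrization_holds : Algebrization :=
  Algebrization.of_aw aaronson_wigderson_collapse_holds aaronson_wigderson_separation_holds

/-- **"Any proof of `P ≠ NP` will require non-algebrizing techniques"**, hypothesis-free: the
separation `NP ⊄ P` is not an algebrizing separation (AW Def. 2.3; `IsAlgebrizingSeparation`).
[cite: AaronsonWigderson2008, Thm. 5.1 with Def. 2.3] -/
theorem not_isAlgebrizingSeparation_NP_P : ¬ IsAlgebrizingSeparation NPRel PRel :=
  Algebrization_holds.not_isAlgebrizingSeparation_NP_P

/-- **"Any proof of `P = NP` would require non-algebrizing techniques"**, hypothesis-free: the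
inclusion `NP ⊆ P` is not an algebrizing inclusion (AW Def. 2.3; `IsAlgebrizingInclusion`).
[cite: AaronsonWigderson2008, Thm. 5.3 with Def. 2.3] -/
theorem not_isAlgebrizingInclusion_NP_P : ¬ IsAlgebrizingInclusion NPRel PRel :=
  Algebrization_holds.not_isAlgebrizingInclusion_NP_P

/-- Both no-go statements at once, hypothesis-free. [cite: AaronsonWigderson2008, §5.1 (Thm. 5.1, Thm. 5.3)] -/
theorem algebrization_summary :
    ¬ IsAlgebrizingSeparation NPRel PRel ∧ ¬ IsAlgebrizingInclusion NPRel PRel :=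
  Algebrization_holds.summary

/-- The two oracle pairs spelled out, hypothesis-free: `∃ A Ã d, Ã` extends `A` `∧ NP^Ã ⊆ P^A`, and
`∃ A Ã d, … ∧ NP^A ⊄ P^Ã`. [cite: AaronsonWigderson2008, Thm. 5.1 and Thm. 5.3] -/
theorem algebrization_oracles :
    (∃ (A : Language Bool) (Ã : ExtensionOracle) (d : ℕ), Ã.IsExtensionOf A d ∧
        NPRel Ã.toOracle ⊆ PRel (Oracle.ofLanguage A)) ∧
      ∃ (A : Language Bool) (Ã : ExtensionOracle) (d : ℕ), Ã.IsExtensionOf A d ∧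
        ¬ NPRel (Oracle.ofLanguage A) ⊆ PRel Ã.toOracle :=
  algebrization_iff.1 Algebrization_holds

/-- The algebrization barrier contains the relativization barrier for the same statements,
hypothesis-free in the barrier fact: given monotonicity of `P^·` resp. `NP^·` from `A` to `Ã`,
neither `O ↦ NP^O ⊆ P^O` nor `O ↦ NP^O ⊄ P^O` relativizes (`Algebrization.not_relativizes`).
[cite: AaronsonWigderson2008, §5.1] [cite: ImpagliazzoKabanetsKolokolova2009, §1 p. 3] -/
theorem algebrization_not_relativizes
    (hP : ∀ (A : Language Bool) (Ã : ExtensionOracle) (d : ℕ), Ã.IsExtensionOf A d →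
      PRel (Oracle.ofLanguage A) ⊆ PRel Ã.toOracle)
    (hNP : ∀ (A : Language Bool) (Ã : ExtensionOracle) (d : ℕ), Ã.IsExtensionOf A d →
      NPRel (Oracle.ofLanguage A) ⊆ NPRel Ã.toOracle) :
    (¬ Relativizes fun O => NPRel O ⊆ PRel O) ∧ ¬ Relativizes fun O => ¬ NPRel O ⊆ PRel O :=
  Algebrization_holds.not_relativizes hP hNP

end AlgebrizationHolds

end Literature.Barriers.PneNP
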